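import Mathlib
import HarnessLib
import Literature.Analysis.FluidPDE.ClassicalSolution
import Literature.Analysis.FluidPDE.ClassicalSolutionRescale
import Literature.Analysis.FluidPDE.FreeSpaceZerothLawRescaling
import Literature.Analysis.FluidPDE.SelfSimilarEulerConeEnergy
import Literature.Analysis.FluidPDE.WholeSpaceIBP
import Literature.Analysis.FunctionSpaces.SobolevDomain
import Literature.Analysis.FunctionSpaces.TorusTestFunction
import Summits.AnomalousDissipation.AnomalousDissipation.Theorems.PointSinkSolitonTransplantStubShellDefectScaling
import Summits.AnomalousDissipation.AnomalousDissipation.Theorems.PointSinkSolitonTransplantStubLocalL2Convergence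

/-!
# Stub `stub_solitonCoreFamily` of the line `Sketch` (crux stmt-AnomalousDissipation-19035,
# `PointSink.SolitonTransplant`): the exact core family of a cascade soliton

Registered signature (proved here, textually; `E³ = EuclideanSpace ℝ (Fin 3)`, `𝕋³ = UnitAddTorus (Fin 3)`
are the skeleton's local notations, redeclared below):
```
theorem stub_solitonCoreFamily :
    ∀ (Q : E³ → E³) (P : E³ → ℝ),
      IsClassicalNSSolutionOn Set.univ 1 (fun _ _ => 0) (fun _ => Q) (fun _ => P) →
      (∃ C : ℝ, ∀ R : ℝ, 1 ≤ R → ∫ x in ball (0 : E³) R, ‖Q x‖ ^ 2 ≤ C * R ^ (5 / 3 : ℝ)) →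
      Integrable (fun x => frobeniusNormSq (fderiv ℝ Q x)) →
      ∀ (lam : ℝ) (V : E³ → E³), 1 < lam → AEStronglyMeasurable V volume →
      (∀ x : E³, x ≠ 0 → V (lam • x) = lam ^ (-(2 / 3 : ℝ)) • V x) →
      LocallyIntegrableOn (fun x => ‖V x‖ ^ 2) {x : E³ | x ≠ 0} volume →
      Tendsto (fun k : ℕ => (lam ^ k) ^ (-(5 / 3 : ℝ)) *
        ∫ x in {x : E³ | lam ^ k < ‖x‖ ∧ ‖x‖ < lam ^ (k + 1)}, ‖Q x - V x‖ ^ 2) atTop (𝓝 0) →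
      (∀ j : ℕ, 0 < (lam ^ j) ^ (-(1 / 3 : ℝ))) ∧
      Tendsto (fun j : ℕ => (lam ^ j) ^ (-(1 / 3 : ℝ))) atTop (𝓝 0) ∧
      (∀ j : ℕ, IsClassicalNSSolutionOn Set.univ ((lam ^ j) ^ (-(1 / 3 : ℝ))) (fun _ _ => 0)
        (fun _ y => (lam ^ j) ^ (2 / 3 : ℝ) • Q (lam ^ j • y))
        (fun _ y => (lam ^ j) ^ (4 / 3 : ℝ) * P (lam ^ j • y))) ∧
      (∀ j : ℕ, Integrable (fun y =>
        frobeniusNormSq (fderiv ℝ (fun y => (lam ^ j) ^ (2 / 3 : ℝ) • Q (lam ^ j • y)) y))) ∧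
      (∀ j : ℕ, (lam ^ j) ^ (-(1 / 3 : ℝ)) *
          ∫ y, frobeniusNormSq (fderiv ℝ (fun y => (lam ^ j) ^ (2 / 3 : ℝ) • Q (lam ^ j • y)) y) =
        ∫ x, frobeniusNormSq (fderiv ℝ Q x)) ∧
      (∀ r : ℝ, 0 < r → Tendsto (fun j : ℕ => (lam ^ j) ^ (-(1 / 3 : ℝ)) *
        ∫ y in {y : E³ | r ≤ ‖y‖},
          frobeniusNormSq (fderiv ℝ (fun y => (lam ^ j) ^ (2 / 3 : ℝ) • Q (lam ^ j • y)) y))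
        atTop (𝓝 0)) ∧
      (∀ r₀ : ℝ, 0 < r₀ → Tendsto (fun j : ℕ =>
        ∫ y in ball (0 : E³) r₀, ‖(lam ^ j) ^ (2 / 3 : ℝ) • Q (lam ^ j • y) - V y‖ ^ 2) atTop (𝓝 0))
```
Proof. Write `μ = λ^j`, `ν = μ^{-1/3}`, `c(y) = μ^{2/3} Q(μ y)`, `π(y) = μ^{4/3} P(μ y)`.
(1)–(2) `ν > 0` and `(λ^j)^{-1/3} = (λ^{-1/3})^j → 0` (`tendsto_pow_atTop_nhds_zero_of_lt_one`).
(3)–(5) are the free-space zeroth-law rescaling facts of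
`Literature/Analysis/FluidPDE/FreeSpaceZerothLawRescaling.lean` at `μ = λ^j`: `(c, π)` is the exact
NS rescaling `α = μ^{2/3}`, `γ = μ` of `IsClassicalNSSolutionOn.stRescale` (viscosity `μ^{-1/3}`, zero
force; `IsClassicalNSSolutionOn.zerothLawRescale_one`), `|∇c|² = μ^{10/3} |∇Q|²(μ ·)` is integrable
(`integrable_frobeniusNormSq_fderiv_const_smul_comp_smul`) and `ν ∫|∇c|² = ∫|∇Q|²`
(`zerothLaw_integral_dissipation`; Frisch 1995, §2.2 with `h = -2/3`). (6) By
`zerothLaw_exterior_dissipation`, `ν ∫_{r ≤ |y|} |∇c|² = ∫_{λ^j r ≤ |x|} |∇Q|²`, the integral of an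
integrable function over an antitone family of sets with empty intersection
(`tendsto_setIntegral_of_antitone`). (7) Split `B_{r₀} = B_r ∪ (B_{r₀} ∖ B_r)`, `r = λ^{-m}`: the
annular part is bounded by `∫_{r/2<|y|<r₀} |c_j − V|² → 0` (the landed `stub_shellDefectScaling` and
`stub_localL2Convergence`); on the small ball, `|c_j − V|² ≤ 2|c_j|² + 2|V|²` with
`∫_{B_r}|c_j|² ≤ C r^{5/3}` once `λ^j r ≥ 1` (mass envelope, `zerothLaw_setIntegral_ball_norm_sq_le`)
and `∫_{B_{λ^{-m}}}|V|² → 0` as `m → ∞` (`DSSCone.normSq_integrableOn_ball` and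
`tendsto_setIntegral_of_antitone`, `⋂ₘ B_{λ^{-m}} ⊆ {0}` is null). Pure proof file (no definitions).
[folklore]
-/

-- `Summit.<Summit>.<Problem>` is the tree's mandated summit-side namespace (CONVENTIONS §2); for this
-- single-conjunct summit the two coincide, so the duplicate is deliberate.
set_option linter.dupNamespace false

noncomputable section

namespace Summit.AnomalousDissipation.AnomalousDissipation.Theorems

open MeasureTheory Filter Topology Set Metric
open scoped InnerProductSpace ContDiff Laplacian
open Literature.Analysis.FunctionSpaces Literature.Analysis.FluidPDE

/-- Physical space `ℝ³` (local notation, as in the registered skeleton). -/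
local notation "E³" => EuclideanSpace ℝ (Fin 3)
/-- The flat three-torus (local notation, as in the registered skeleton). -/
local notation "𝕋³" => UnitAddTorus (Fin 3)

/-! ### Two limits along `μ = λ^j` -/

/-- `(λ^j)^{-1/3} = (λ^{-1/3})^j` for `λ ≥ 0`. [folklore] -/
private theorem rpow_pow_neg_third {lam : ℝ} (hlam : 0 ≤ lam) (j : ℕ) :
    (lam ^ j) ^ (-(1 / 3 : ℝ)) = (lam ^ (-(1 / 3 : ℝ))) ^ j := by
  rw [← Real.rpow_natCast_mul hlam, mul_comm, Real.rpow_mul_natCast hlam]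

/-- **Vanishing tails.** For integrable `G`, `λ > 1`, `r > 0`: `∫_{λ^j r ≤ |x|} G → 0` as `j → ∞`
(antitone sets with empty intersection, `tendsto_setIntegral_of_antitone`). [folklore] -/
private theorem tendsto_setIntegral_exterior {G : E³ → ℝ} (hG : Integrable G) {lam r : ℝ}
    (hlam : 1 < lam) (hr : 0 < r) :
    Tendsto (fun j : ℕ => ∫ x in {x : E³ | lam ^ j * r ≤ ‖x‖}, G x) atTop (𝓝 0) := by
  have hanti : Antitone fun j : ℕ => {x : E³ | lam ^ j * r ≤ ‖x‖} := fun j k hjk x hx =>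
    le_trans (mul_le_mul_of_nonneg_right (pow_le_pow_right₀ hlam.le hjk) hr.le) hx
  have hmeas : ∀ j : ℕ, MeasurableSet {x : E³ | lam ^ j * r ≤ ‖x‖} := fun j =>
    measurableSet_le measurable_const measurable_norm
  have hlim := tendsto_setIntegral_of_antitone hmeas hanti ⟨0, hG.integrableOn⟩
  have hempty : (⋂ j : ℕ, {x : E³ | lam ^ j * r ≤ ‖x‖}) = ∅ := by
    refine Set.eq_empty_of_forall_notMem fun x hx => ?_
    obtain ⟨n, hn⟩ := pow_unbounded_of_one_lt (‖x‖ / r) hlam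
    have hx' : lam ^ n * r ≤ ‖x‖ := Set.mem_iInter.1 hx n
    rw [div_lt_iff₀ hr] at hn
    linarith
  rw [hempty, setIntegral_empty] at hlim
  exact hlim

/-! ### `L²` convergence on balls -/

/-- `|u − v|² ≤ 2|u|² + 2|v|²`. [folklore] -/
private theorem norm_sub_sq_le_two_mul (u v : E³) : ‖u - v‖ ^ 2 ≤ 2 * ‖u‖ ^ 2 + 2 * ‖v‖ ^ 2 := by
  -- adapted from `stub_localL2Convergence` (Theorems/PointSinkSolitonTransplantStubLocalL2Convergence)
  have h1 : ‖u - v‖ ^ 2 ≤ (‖u‖ + ‖v‖) ^ 2 := pow_le_pow_left₀ (norm_nonneg _) (norm_sub_le u v) 2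
  nlinarith [sq_nonneg (‖u‖ - ‖v‖)]

/-- On a bounded set `K` carrying `|V|² ∈ L¹(K)`, the defect density `|Q' − V|²` (`Q'` continuous, `V`
a.e.-strongly measurable) is integrable: dominated by `2|Q'|² + 2|V|²`. [folklore] -/
private theorem integrableOn_normSq_sub {Q' V : E³ → E³} {K : Set E³} (hQ' : Continuous Q')
    (hV : AEStronglyMeasurable V volume) (hVK : IntegrableOn (fun x => ‖V x‖ ^ 2) K volume)
    (hK : Bornology.IsBounded K) : IntegrableOn (fun x => ‖Q' x - V x‖ ^ 2) K volume := by
  -- adapted from `stub_localL2Convergence` (Theorems/PointSinkSolitonTransplantStubLocalL2Convergence)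
  obtain ⟨R, hR⟩ := hK.subset_closedBall 0
  have hQK : IntegrableOn (fun x => ‖Q' x‖ ^ 2) K volume :=
    ((hQ'.norm.pow 2).continuousOn.integrableOn_compact (isCompact_closedBall 0 R)).mono_set hR
  have hmeas : AEStronglyMeasurable (fun x => ‖Q' x - V x‖ ^ 2) (volume.restrict K) :=
    ((continuous_norm.pow 2).comp_aestronglyMeasurable (hQ'.aestronglyMeasurable.sub hV)).restrict
  have hg : Integrable (fun x => 2 * ‖Q' x‖ ^ 2 + 2 * ‖V x‖ ^ 2) (volume.restrict K) :=
    (hQK.const_mul 2).add (hVK.const_mul 2)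
  refine hg.mono' hmeas (Eventually.of_forall fun x => ?_)
  rw [Real.norm_of_nonneg (sq_nonneg _)]
  exact norm_sub_sq_le_two_mul (Q' x) (V x)

/-- **Small balls carry little energy.** For `g ∈ L¹(B₁)` and `λ > 1`, `∫_{B_{λ^{-m}}} g → 0` as
`m → ∞` (`tendsto_setIntegral_of_antitone`; `⋂ₘ B_{λ^{-m}} ⊆ {0}` is Lebesgue-null). [folklore] -/
private theorem tendsto_setIntegral_ball_inv_pow {g : E³ → ℝ} (hg : IntegrableOn g (ball 0 1) volume)
    {lam : ℝ} (hlam : 1 < lam) :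
    Tendsto (fun m : ℕ => ∫ x in ball (0 : E³) (lam ^ m)⁻¹, g x) atTop (𝓝 0) := by
  have hlam0 : 0 < lam := one_pos.trans hlam
  have hanti : Antitone fun m : ℕ => ball (0 : E³) (lam ^ m)⁻¹ := fun m n hmn =>
    ball_subset_ball (inv_anti₀ (pow_pos hlam0 m) (pow_le_pow_right₀ hlam.le hmn))
  have hlim := tendsto_setIntegral_of_antitone (fun m => measurableSet_ball) hanti
    ⟨0, by simpa using hg⟩
  have hnull : volume (⋂ m : ℕ, ball (0 : E³) (lam ^ m)⁻¹) = 0 := by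
    refine measure_mono_null (fun x hx => ?_) (measure_singleton (0 : E³))
    rw [Set.mem_singleton_iff]
    by_contra hx0
    have hxn : 0 < ‖x‖ := norm_pos_iff.2 hx0
    obtain ⟨n, hn⟩ := pow_unbounded_of_one_lt ‖x‖⁻¹ hlam
    have hxb : ‖x‖ < (lam ^ n)⁻¹ := mem_ball_zero_iff.1 (Set.mem_iInter.1 hx n)
    have := (lt_inv_comm₀ hxn (pow_pos hlam0 n)).1 hxb
    linarith
  rw [setIntegral_measure_zero _ hnull] at hlim
  exact hlim

/-- **`L²(B_{r₀})` convergence from annuli and a uniform core bound.** If the continuous fields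
`c_j` converge to `V` in `L²` of every annulus `a < |x| < b` (`0 < a < b`), their masses on small
balls are eventually bounded by `C r^{5/3}`, and `|V|² ∈ L¹(B₁) ∩ L¹_loc(ℝ³ ∖ 0)`, then
`∫_{B_{r₀}} |c_j − V|² → 0` (split `B_{r₀} = B_r ∪ (B_{r₀} ∖ B_r)` with `r = λ^{-m}` small). [folklore] -/
private theorem tendsto_setIntegral_ball_of_annuli {c : ℕ → E³ → E³} {V : E³ → E³} {C : ℝ}
    (hc : ∀ j, Continuous (c j)) (hV : AEStronglyMeasurable V volume)
    (hVloc : LocallyIntegrableOn (fun x => ‖V x‖ ^ 2) {x : E³ | x ≠ 0} volume)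
    (hVball : IntegrableOn (fun x => ‖V x‖ ^ 2) (ball 0 1) volume) {lam : ℝ} (hlam : 1 < lam)
    (hann : ∀ a b : ℝ, 0 < a → a < b →
      Tendsto (fun j : ℕ => ∫ x in {x : E³ | a < ‖x‖ ∧ ‖x‖ < b}, ‖c j x - V x‖ ^ 2) atTop (𝓝 0))
    (hcore : ∀ r : ℝ, 0 < r →
      ∀ᶠ j : ℕ in atTop, ∫ y in ball (0 : E³) r, ‖c j y‖ ^ 2 ≤ C * r ^ (5 / 3 : ℝ))
    {r₀ : ℝ} (hr₀ : 0 < r₀) :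
    Tendsto (fun j : ℕ => ∫ y in ball (0 : E³) r₀, ‖c j y - V y‖ ^ 2) atTop (𝓝 0) := by
  have hlam0 : 0 < lam := one_pos.trans hlam
  refine tendsto_order.2 ⟨fun a ha => Eventually.of_forall fun j =>
    ha.trans_le (integral_nonneg fun y => sq_nonneg _), fun ε hε => ?_⟩
  -- Step 1: the inner radius `r = λ^{-m}`
  have hr_tend : Tendsto (fun m : ℕ => (lam ^ m)⁻¹) atTop (𝓝 0) :=
    tendsto_inv_atTop_zero.comp (tendsto_pow_atTop_atTop_of_one_lt hlam)
  have e1 : ∀ᶠ m : ℕ in atTop, (lam ^ m)⁻¹ < r₀ := hr_tend.eventually (gt_mem_nhds hr₀)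
  have e2 : ∀ᶠ m : ℕ in atTop, C * ((lam ^ m)⁻¹) ^ (5 / 3 : ℝ) < ε / 6 := by
    have h : Tendsto (fun m : ℕ => C * ((lam ^ m)⁻¹) ^ (5 / 3 : ℝ)) atTop (𝓝 0) := by
      simpa using (hr_tend.rpow_const_nhds_zero (p := (5 / 3 : ℝ)) (by norm_num)).const_mul C
    exact h.eventually (gt_mem_nhds (by linarith))
  have e3 : ∀ᶠ m : ℕ in atTop, ∫ x in ball (0 : E³) (lam ^ m)⁻¹, ‖V x‖ ^ 2 < ε / 6 :=
    (tendsto_setIntegral_ball_inv_pow hVball hlam).eventually (gt_mem_nhds (by linarith))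
  obtain ⟨m, hm1, hm2, hm3⟩ := (e1.and (e2.and e3)).exists
  set r : ℝ := (lam ^ m)⁻¹ with hr_def
  have hr : 0 < r := inv_pos.2 (pow_pos hlam0 m)
  have hr1 : r ≤ 1 := inv_le_one_of_one_le₀ (one_le_pow₀ hlam.le)
  -- Step 2: for `j` large the core mass bound and the annular convergence are available
  have e4 : ∀ᶠ j : ℕ in atTop, ∫ y in ball (0 : E³) r, ‖c j y‖ ^ 2 ≤ C * r ^ (5 / 3 : ℝ) :=
    hcore r hr
  have e5 : ∀ᶠ j : ℕ in atTop,
      ∫ x in {x : E³ | r / 2 < ‖x‖ ∧ ‖x‖ < r₀}, ‖c j x - V x‖ ^ 2 < ε / 3 :=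
    (hann (r / 2) r₀ (by positivity) (by linarith)).eventually (gt_mem_nhds (by linarith))
  filter_upwards [e4, e5] with j hj4 hj5
  -- Step 3: integrability of the defect on the two pieces
  have hIball : IntegrableOn (fun y => ‖c j y - V y‖ ^ 2) (ball 0 r) volume :=
    integrableOn_normSq_sub (hc j) hV (hVball.mono_set (ball_subset_ball hr1)) isBounded_ball
  have hAK : {x : E³ | r / 2 < ‖x‖ ∧ ‖x‖ < r₀} ⊆ closedBall (0 : E³) r₀ \ ball 0 (r / 2) :=
    fun x hx => ⟨mem_closedBall_zero_iff.2 hx.2.le, fun h => lt_asymm hx.1 (mem_ball_zero_iff.1 h)⟩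
  have hK0 : closedBall (0 : E³) r₀ \ ball 0 (r / 2) ⊆ {x : E³ | x ≠ 0} := fun x hx h0 =>
    hx.2 (by rw [h0]; exact mem_ball_self (by positivity))
  have hIA : IntegrableOn (fun y => ‖c j y - V y‖ ^ 2) {x : E³ | r / 2 < ‖x‖ ∧ ‖x‖ < r₀} volume :=
    (integrableOn_normSq_sub (hc j) hV
      (hVloc.integrableOn_compact_subset hK0 ((isCompact_closedBall 0 r₀).diff isOpen_ball))
      (isBounded_closedBall.subset Set.sdiff_subset)).mono_set hAK
  have hdiff_sub : ball (0 : E³) r₀ \ ball 0 r ⊆ {x : E³ | r / 2 < ‖x‖ ∧ ‖x‖ < r₀} := fun x hx =>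
    ⟨by have h := hx.2; rw [mem_ball_zero_iff, not_lt] at h; linarith, mem_ball_zero_iff.1 hx.1⟩
  have hIdiff : IntegrableOn (fun y => ‖c j y - V y‖ ^ 2) (ball 0 r₀ \ ball 0 r) volume :=
    hIA.mono_set hdiff_sub
  -- Step 4: split and estimate
  have hsplit : ∫ y in ball (0 : E³) r₀, ‖c j y - V y‖ ^ 2 =
      (∫ y in ball (0 : E³) r, ‖c j y - V y‖ ^ 2) +
        ∫ y in ball (0 : E³) r₀ \ ball 0 r, ‖c j y - V y‖ ^ 2 := by
    rw [← setIntegral_union disjoint_sdiff_right (measurableSet_ball.diff measurableSet_ball) hIball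
      hIdiff, Set.union_sdiff_cancel (ball_subset_ball hm1.le)]
  have hb1 : ∫ y in ball (0 : E³) r₀ \ ball 0 r, ‖c j y - V y‖ ^ 2 ≤
      ∫ y in {x : E³ | r / 2 < ‖x‖ ∧ ‖x‖ < r₀}, ‖c j y - V y‖ ^ 2 :=
    setIntegral_mono_set hIA (Eventually.of_forall fun y => sq_nonneg _)
      (Eventually.of_forall hdiff_sub)
  have hIQ : IntegrableOn (fun y => ‖c j y‖ ^ 2) (ball (0 : E³) r) volume :=
    (((hc j).norm.pow 2).continuousOn.integrableOn_compact (isCompact_closedBall 0 r)).mono_set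
      ball_subset_closedBall
  have hIV : IntegrableOn (fun y => ‖V y‖ ^ 2) (ball (0 : E³) r) volume :=
    hVball.mono_set (ball_subset_ball hr1)
  have hb2 : ∫ y in ball (0 : E³) r, ‖c j y - V y‖ ^ 2 ≤
      2 * (∫ y in ball (0 : E³) r, ‖c j y‖ ^ 2) + 2 * ∫ y in ball (0 : E³) r, ‖V y‖ ^ 2 := by
    rw [← integral_const_mul, ← integral_const_mul,
      ← integral_add (hIQ.const_mul 2) (hIV.const_mul 2)]
    exact integral_mono hIball ((hIQ.const_mul 2).add (hIV.const_mul 2))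
      fun y => norm_sub_sq_le_two_mul _ _
  rw [hsplit]
  linarith

/-! ### The registered stub -/

/-- **S6b `stub_solitonCoreFamily`.** THE EXACT CORE FAMILY of a cascade soliton: along
`ν_j = (λ^j)^{-1/3} → 0⁺` the exact NS rescalings `c_j(y) = (λ^j)^{2/3} Q(λ^j y)`,
`π_j(y) = (λ^j)^{4/3} P(λ^j y)` are smooth steady zero-force `NS_{ν_j}` solutions on `ℝ³`
(`IsClassicalNSSolutionOn.stRescale`), with integrable `|∇c_j|²`, the exact dissipation identity
`ν_j ∫|∇c_j|² = ∫|∇Q|²` (free-space zeroth law), concentration `ν_j ∫_{|y| ≥ r}|∇c_j|² → 0`, and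
`L²(B_{r₀})` convergence to the DSS far field `V` (annuli: `stub_shellDefectScaling`,
`stub_localL2Convergence`; centre: mass envelope and `DSSCone.normSq_integrableOn_ball`). [folklore] -/
theorem stub_solitonCoreFamily :
    ∀ (Q : E³ → E³) (P : E³ → ℝ),
      IsClassicalNSSolutionOn Set.univ 1 (fun _ _ => 0) (fun _ => Q) (fun _ => P) →
      (∃ C : ℝ, ∀ R : ℝ, 1 ≤ R → ∫ x in ball (0 : E³) R, ‖Q x‖ ^ 2 ≤ C * R ^ (5 / 3 : ℝ)) →
      Integrable (fun x => frobeniusNormSq (fderiv ℝ Q x)) →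
      ∀ (lam : ℝ) (V : E³ → E³), 1 < lam → AEStronglyMeasurable V volume →
      (∀ x : E³, x ≠ 0 → V (lam • x) = lam ^ (-(2 / 3 : ℝ)) • V x) →
      LocallyIntegrableOn (fun x => ‖V x‖ ^ 2) {x : E³ | x ≠ 0} volume →
      Tendsto (fun k : ℕ => (lam ^ k) ^ (-(5 / 3 : ℝ)) *
        ∫ x in {x : E³ | lam ^ k < ‖x‖ ∧ ‖x‖ < lam ^ (k + 1)}, ‖Q x - V x‖ ^ 2) atTop (𝓝 0) →
      (∀ j : ℕ, 0 < (lam ^ j) ^ (-(1 / 3 : ℝ))) ∧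
      Tendsto (fun j : ℕ => (lam ^ j) ^ (-(1 / 3 : ℝ))) atTop (𝓝 0) ∧
      (∀ j : ℕ, IsClassicalNSSolutionOn Set.univ ((lam ^ j) ^ (-(1 / 3 : ℝ))) (fun _ _ => 0)
        (fun _ y => (lam ^ j) ^ (2 / 3 : ℝ) • Q (lam ^ j • y))
        (fun _ y => (lam ^ j) ^ (4 / 3 : ℝ) * P (lam ^ j • y))) ∧
      (∀ j : ℕ, Integrable (fun y =>
        frobeniusNormSq (fderiv ℝ (fun y => (lam ^ j) ^ (2 / 3 : ℝ) • Q (lam ^ j • y)) y))) ∧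
      (∀ j : ℕ, (lam ^ j) ^ (-(1 / 3 : ℝ)) *
          ∫ y, frobeniusNormSq (fderiv ℝ (fun y => (lam ^ j) ^ (2 / 3 : ℝ) • Q (lam ^ j • y)) y) =
        ∫ x, frobeniusNormSq (fderiv ℝ Q x)) ∧
      (∀ r : ℝ, 0 < r → Tendsto (fun j : ℕ => (lam ^ j) ^ (-(1 / 3 : ℝ)) *
        ∫ y in {y : E³ | r ≤ ‖y‖},
          frobeniusNormSq (fderiv ℝ (fun y => (lam ^ j) ^ (2 / 3 : ℝ) • Q (lam ^ j • y)) y))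
        atTop (𝓝 0)) ∧
      (∀ r₀ : ℝ, 0 < r₀ → Tendsto (fun j : ℕ =>
        ∫ y in ball (0 : E³) r₀, ‖(lam ^ j) ^ (2 / 3 : ℝ) • Q (lam ^ j • y) - V y‖ ^ 2) atTop (𝓝 0)) := by
  intro Q P hNS hmass hDint lam V hlam hVm hDSS hVloc hshell
  have hlam0 : 0 < lam := one_pos.trans hlam
  have hQc : Continuous Q := (hNS.contDiff_velocity (Set.mem_univ (0 : ℝ))).continuous
  obtain ⟨C, hC⟩ := hmass
  -- the landed far-field package: annular `L²` convergence of the rescalings to `V`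
  have hS2 := stub_localL2Convergence Q V lam hlam hQc hVm hVloc
    (stub_shellDefectScaling Q V lam hlam hDSS hshell)
  have hVball := DSSCone.normSq_integrableOn_ball hlam hDSS hVloc
  refine ⟨fun j => Real.rpow_pos_of_pos (pow_pos hlam0 j) _, ?_,
    fun j => hNS.zerothLawRescale_one (pow_pos hlam0 j),
    fun j => integrable_frobeniusNormSq_fderiv_const_smul_comp_smul hDint _ (pow_pos hlam0 j).ne',
    fun j => zerothLaw_integral_dissipation Q (pow_pos hlam0 j), fun r hr => ?_, fun r₀ hr₀ => ?_⟩
  · -- `ν_j = (λ^{-1/3})^j → 0`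
    exact (tendsto_pow_atTop_nhds_zero_of_lt_one (Real.rpow_nonneg hlam0.le _)
      (Real.rpow_lt_one_of_one_lt_of_neg hlam (by norm_num))).congr
      fun j => (rpow_pow_neg_third hlam0.le j).symm
  · -- concentration of the dissipation at the origin
    exact (tendsto_setIntegral_exterior hDint hlam hr).congr
      fun j => (zerothLaw_exterior_dissipation Q (pow_pos hlam0 j) r).symm
  · -- `L²(B_{r₀})` convergence to the cone
    exact tendsto_setIntegral_ball_of_annuli (c := fun j y => (lam ^ j) ^ (2 / 3 : ℝ) • Q (lam ^ j • y))
      (fun j => by fun_prop) hVm hVloc hVball hlam hS2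
      (fun r hr => (((tendsto_pow_atTop_atTop_of_one_lt hlam).atTop_mul_const hr).eventually_ge_atTop
        1).mono fun j hj => zerothLaw_setIntegral_ball_norm_sq_le hC hr (pow_pos hlam0 j) hj) hr₀

end Summit.AnomalousDissipation.AnomalousDissipation.Theorems

end
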